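import Summits.BirchSwinnertonDyer.BirchSwinnertonDyer.Theses.SignedBaseChange
import HarnessLib

/-!
# `SignedBaseChange.Assembly` holds (route SignedBaseChange, item kind `assembly`, rank 1; item stmt-BirchSwinnertonDyer-20252)

The assembly `TwistPairGreenbergProductDivisibility → SignedDescentFromGreenbergProduct →
KobayashiMainConjectureSmallImage → CornerX7AtThree → PublishedSignedInputs → Summit.BirchSwinnertonDyer.WAllCornerX7`
is pure logic plus the tree's landed consumers: fix `W`, `p` with `¬CM`, `p ≠ 2`, `ClassX7 W p`, analytic rank `≤ 1`.
If `5 ≤ p`: `a_p = 0` (`Rank1Residual.Supersingular.ClassX7.frobeniusTrace_eq_zero_of_five_le`); `Surj` ⇒ K2 (fed with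
Kobayashi Thm 4.1 / Thm 1.2 from the support) applied to K1's package (modularity from the support) gives Kobayashi's
main conjecture for `ε = 1`; `¬Surj` ⇒ K3 gives it for some `ε`; then rank 0:
`Supersingular.bsdp_of_kobayashiMainConjecture_of_analyticRank_eq_zero` (Pollack pair supply, BDKim2013 Cor 3.15,
`ClassX7.irr`), rank 1: `Supersingular.X7.bsdp_of_kobayashiMainConjecture_of_corA5_of_analyticRank_eq_one`.
Else `p = 3` (`interval_cases`) and the residual R applies.
The statement is written and PRINTED fully qualified (hub dedup keys on the printed type; lesson of
`SignedLowerHalvesAssembly` v2). Proof transferred verbatim from the opening planner's Sketch.lean (`assembly_holds`,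
rc 0; copy run/shared/lean/pub/bsd-wall/bsd-wall-ss/Sketch.lean).
File with: `ledger propose --kind proof --target Summits/BirchSwinnertonDyer/BirchSwinnertonDyer/Theorems/SignedBaseChangeAssembly.lean
  --file <this> --workitem stmt-BirchSwinnertonDyer-20252`.
-/

set_option autoImplicit false

namespace Summit.BirchSwinnertonDyer.BirchSwinnertonDyer.Theorems.SignedBaseChangeAssembly

/-- The route's assembly item: K1, K2, K3, the `p = 3` residual and the published inputs imply the rung leaf
`WAllCornerX7` (W-ALL row 7). -/
theorem assembly_holds :
    Summit.BirchSwinnertonDyer.BirchSwinnertonDyer.Theses.SignedBaseChange.Assembly := by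
  intro h₁ h₂ h₃ h₄ h₅ W _ _ p _ hcm hp2 hX hr
  obtain ⟨-, h12, h41, hKim, hA5, -, -, hmodP, hmod, hGZK⟩ := h₅
  by_cases hp5 : 5 ≤ p
  · have hap : W.frobeniusTrace p = 0 :=
      Summit.BirchSwinnertonDyer.Rank1Residual.Supersingular.ClassX7.frobeniusTrace_eq_zero_of_five_le W p hp5 hX
    have hMC : ∃ ε : ℤˣ, Summit.BirchSwinnertonDyer.Rank1Residual.Supersingular.KobayashiMainConjecture W p ε := by
      by_cases hs : Literature.NumberTheory.EllipticCurves.Rank1Residual.Surj W p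
      · exact ⟨1, h₂ h41 h12 W p hp5 hX hs (h₁ hmodP W p hp5 hX hs) 1⟩
      · exact h₃ W p hp2 hX hcm hap hs
    obtain ⟨ε, hε⟩ := hMC
    rcases Nat.le_one_iff_eq_zero_or_eq_one.mp hr with h0 | h1
    · exact Summit.BirchSwinnertonDyer.Rank1Residual.Supersingular.bsdp_of_kobayashiMainConjecture_of_analyticRank_eq_zero
        W p h12 hKim Literature.NumberTheory.EllipticCurves.pollack_exists_plusMinusPAdicLFunction_holds hmodP hmod hGZK
        hp2 hX.1.1 hap (Literature.NumberTheory.EllipticCurves.Rank1Residual.ClassX7.irr W p hp2 hX) h0 hε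
    · exact Summit.BirchSwinnertonDyer.Rank1Residual.Supersingular.X7.bsdp_of_kobayashiMainConjecture_of_corA5_of_analyticRank_eq_one
        W p hA5 hmod hGZK hp2 hX hap h1 ε hε
  · have hp3 : p = 3 := by
      have hpp : p.Prime := Fact.out
      have h2le := hpp.two_le
      interval_cases p
      · exact absurd rfl hp2
      · rfl
      · exact absurd hpp (by decide)
    exact h₄ W p hp3 hcm hX hr

end Summit.BirchSwinnertonDyer.BirchSwinnertonDyer.Theorems.SignedBaseChangeAssembly
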